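import Summits.QuantumFields.YangMills.Theorems.ForcedResponseSkewnessResponseLocalisationDefs
import Summits.QuantumFields.YangMills.Theorems.ForcedResponseSkewnessResponseLocalisationFarStub
import Summits.QuantumFields.YangMills.Theorems.BalabanLadderUVSeamRecFloorsEngineOfQ3MirrorFloor
import HarnessLib

/-!
# Crux `ResponseLocalisation` (rev 5, stmt-QuantumFields-24869), line «collar-kernel»: registered stub `stub_collarOfKernel`

`Summit.QuantumFields.YangMills.Cruxes.ResponseLocalisation.Collar.stub_collarOfKernel : CollarOfKernelSigR` — the ANALYSIS stub of the
lead's line «collar-kernel» (width prover `ym-line-frs-p2`, STUB BRIEF of 2026-08-28): the kernel-level near-insertion ceiling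
`ContactKernelSigR` (the line's PHYSICS stub, NOT proved here) implies the rev-4/5 crux body (the δ-collar bound with `0 < p 0`).

Proof (smearing/geometry only): if no pinning witness exists the source family is empty (any admissible `v` would be one); otherwise the
kernel is instantiated at separations `[p₀/Λ, 2‖p‖ + p₀]` and `κ = η/8`, giving a radius `R`; take `ρ = min (p₀/2) (R/4)` and, per source,
`δ = R/4`.  A charged pair `(y, z)` (`θv(s y) ≠ 0`, `v(s z) ≠ 0`, `s = l·aβ`) sits at unit-`a` torus separation in `[p₀/Λ, 2‖p‖+p₀]`
(`…UniformSmearPrep.pair_coords/pair_torusDist`, no wrap-around on tori `aβ·L ≥ Λ₆`); a collar site `x` (`infDist(s x, K) < δ`,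
`K = tsupport v ∪ tsupport θv ⊆ closedBall p ρ ∪ θ⁻¹ closedBall p ρ`) is within unit-`a` torus distance `R` of `z` or of `y`, so the collar
sum of `|torusK3 x y z|` is at most the two kernel sums (`torusK3` is symmetric in `y, z`), i.e. `≤ 2κ(aβ)⁸`; the Riemann sums
`s⁴Σ|θv(s·)|, s⁴Σ|v(s·)| ≤ 2` (`…UniformSmearPrep.exists_latticeSum_abs_le`) then give `≤ 8κ(aβ/s)⁸ ≤ η ≤ η(1+|∂_cQ2|)`.

Honest label: closes ONE analysis stub of a CONDITIONAL rung line (leaf R2a `BalabanLadder.NT`); the physics stub `stub_contactKernel`, the crux,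
NT and the Yang–Mills mass gap are NOT proved by any of this.
-/

set_option autoImplicit false

noncomputable section

open MeasureTheory Filter Topology Metric
open scoped SchwartzMap
open Literature.MathematicalPhysics.QuantumFieldTheory
open Literature.MathematicalPhysics.QuantumLattice hiding torusDist
open Literature.Probability.LatticeModels
open Summit.QuantumFields.YangMills.Cruxes.OSLegsFromFemtoAndGap.DlrCollarTransfer
open Summit.QuantumFields.YangMills.Cruxes.RunningCouplingCeiling.Pointwise
open Summit.QuantumFields.YangMills.Cruxes.ResponseLocalisation.Birth
open Summit.QuantumFields.YangMills.Cruxes.ResponseLocalisation.Far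

namespace Summit.QuantumFields.YangMills.Cruxes.ResponseLocalisation.Collar

/-! ## Small symmetric facts -/

/-- The torus distance is symmetric. [folklore] -/
theorem torusDist_comm (L : ℕ) (x y : Fin 4 → ℤ) : torusDist L x y = torusDist L y x := by
  unfold torusDist
  congr 1
  refine Finset.sum_congr rfl fun k _ => ?_
  have h : ((y k - x k : ℤ) : ZMod (2 * L + 1)) = -((x k - y k : ℤ) : ZMod (2 * L + 1)) := by push_cast; ring
  have habs : |((((x k - y k : ℤ) : ZMod (2 * L + 1))).valMinAbs : ℤ)| =
      |((((y k - x k : ℤ) : ZMod (2 * L + 1))).valMinAbs : ℤ)| := by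
    rw [h, Int.abs_eq_natAbs, Int.abs_eq_natAbs, ZMod.natAbs_valMinAbs_neg]
  have h2 : ((((x k - y k : ℤ) : ZMod (2 * L + 1))).valMinAbs : ℤ) ^ 2 =
      ((((y k - x k : ℤ) : ZMod (2 * L + 1))).valMinAbs : ℤ) ^ 2 := by
    rw [← sq_abs, habs, sq_abs]
  exact_mod_cast congrArg (fun t : ℤ => (t : ℝ)) h2

section Torus

variable (G : Type) [Group G] [TopologicalSpace G] [IsTopologicalGroup G] [CompactSpace G]
  [MeasurableSpace G] [BorelSpace G] (r : LatticeRep G)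

/-- The torus third cumulant is symmetric in its last two arguments. [folklore] -/
theorem torusK3_swap (β : ℝ) (L : ℕ) (x y z : Fin 4 → ℤ) :
    torusK3 G r β L x z y = torusK3 G r β L x y z := by
  unfold torusK3
  have e1 : (fun U : Literature.MathematicalPhysics.QuantumLattice.LGConfig 4 G => dens G r x U * dens G r z U * dens G r y U) =
      fun U => dens G r x U * dens G r y U * dens G r z U := by
    funext U; ring
  have e2 : (fun U : Literature.MathematicalPhysics.QuantumLattice.LGConfig 4 G => dens G r z U * dens G r y U) = fun U => dens G r y U * dens G r z U := by
    funext U; ring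
  rw [e1, e2]
  ring

end Torus

/-! ## The stub -/

/-- **Registered stub `stub_collarOfKernel` of line «collar-kernel»**: the kernel-level near-insertion ceiling implies the rev-5 crux
`ResponseLocalisation` (contact half, `0 < p 0`).  See the module docstring for the reduction; the kernel `ContactKernelSigR` is the
hypothesis. [folklore] -/
theorem stub_collarOfKernel : CollarOfKernelSigR := by
  intro hK G _ _ _ _ hG
  letI : MeasurableSpace G := borel G
  haveI : BorelSpace G := ⟨rfl⟩
  intro r a hpos hlim p hp0 ε hε η hη Λ hΛ
  classical
  have hΛ0 : 0 < Λ := by linarith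
  have hp0n : p 0 ≤ ‖p‖ := by
    have h := PiLp.norm_apply_le p (0 : Fin 4)
    rw [Real.norm_eq_abs] at h
    exact (le_abs_self _).trans h
  -- (1) the pinning witness: if there is none, the admissible family is empty
  by_cases hW : ∃ (v₀ : 𝓢(EuclideanSpace ℝ (Fin 4), ℝ)) (ε' β₅ Λ₅ : ℝ), HasCompactSupport v₀ ∧
      tsupport v₀ ⊆ {y : EuclideanSpace ℝ (Fin 4) | 0 < y 0} ∧ 0 < ε' ∧
      ∀ β : ℝ, β₅ ≤ β → ∀ L : ℕ, Λ₅ ≤ a β * L → ε' ≤ Q2 G r β L (a β) (thetaTest 4 v₀) v₀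
  swap
  · refine ⟨p 0 / 2, by positivity, fun v hball hsupp _ hfloor => ?_⟩
    exfalso
    obtain ⟨β₅, Λ₅, hfl⟩ := hfloor
    exact hW ⟨v, ε, β₅, Λ₅, (isCompact_closedBall p (p 0 / 2)).of_isClosed_subset (isClosed_tsupport _) hball,
      hsupp, hε, hfl⟩
  -- (2) the kernel at separations `[p₀/Λ, 2‖p‖ + p₀]` and `κ = η/8`
  have hr₁ : 0 < p 0 / Λ := by positivity
  have hr₁₂ : p 0 / Λ ≤ 2 * ‖p‖ + p 0 := by
    have h1 : p 0 / Λ ≤ p 0 := div_le_self hp0.le hΛ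
    linarith [norm_nonneg p]
  have hκ : 0 < η / 8 := by positivity
  obtain ⟨R, hR, β₀, Λ₀, hker⟩ := hK G hG r a hpos hlim hW (p 0 / Λ) (2 * ‖p‖ + p 0) hr₁ hr₁₂ (η / 8) hκ
  set ρ : ℝ := min (p 0 / 2) (R / 4) with hρ
  have hρ0 : 0 < ρ := lt_min (by positivity) (by positivity)
  have hρp : ρ ≤ p 0 / 2 := min_le_left _ _
  have hρR : ρ ≤ R / 4 := min_le_right _ _
  refine ⟨ρ, hρ0, fun v hball hsupp hL1 _ => ?_⟩
  -- per source: Riemann thresholds, `δ = R/4`, coupling and torus thresholds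
  set R' : ℝ := ‖p‖ + ρ with hR'
  have hR'0 : 0 ≤ R' := by positivity
  have hvR : tsupport (v : EuclideanSpace ℝ (Fin 4) → ℝ) ⊆ closedBall 0 R' := by
    refine hball.trans (closedBall_subset_closedBall' ?_)
    rw [dist_zero_right]; linarith
  have hθR := Summit.QuantumFields.YangMills.Cruxes.NT.Reference.tsupport_thetaTest_subset_closedBall_zero hvR
  obtain ⟨s₁, hs₁, h₁⟩ := exists_latticeSum_abs_le v hvR
  obtain ⟨s₂, hs₂, h₂⟩ := exists_latticeSum_abs_le (thetaTest 4 v) hθR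
  set s₀ : ℝ := min (min s₁ s₂) 1 with hs₀
  have hs₀0 : 0 < s₀ := by positivity
  have hev : ∀ᶠ β in atTop, a β < s₀ / Λ := hlim.eventually (gt_mem_nhds (by positivity))
  obtain ⟨β₂, hβ₂⟩ := Filter.eventually_atTop.mp hev
  refine ⟨R / 4, by positivity, max β₀ β₂, max Λ₀ (2 * R' + 1), fun β hβ L hL l hl => ?_⟩
  have hβ0 : β₀ ≤ β := le_trans (le_max_left _ _) hβ
  have hβ2 : β₂ ≤ β := le_trans (le_max_right _ _) hβ
  have hLΛ₀ : Λ₀ ≤ a β * L := le_trans (le_max_left _ _) hL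
  have hL2R : 2 * R' + 1 ≤ a β * L := le_trans (le_max_right _ _) hL
  have haβ : 0 < a β := hpos β
  -- the spacing `s = l · aβ`
  set s : ℝ := l * a β with hsdef
  have hl1 : 1 ≤ l := hl.1
  have hs : 0 < s := mul_pos (by linarith) haβ
  have hsaβ : a β ≤ s := by
    have := mul_le_mul_of_nonneg_right hl1 haβ.le
    rw [hsdef]; linarith
  have hsΛ : s ≤ Λ * a β := by rw [hsdef]; exact mul_le_mul_of_nonneg_right hl.2 haβ.le
  have hss₀ : s ≤ s₀ := by
    have h1 : a β < s₀ / Λ := hβ₂ β hβ2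
    have h2 : Λ * a β ≤ Λ * (s₀ / Λ) := mul_le_mul_of_nonneg_left h1.le hΛ0.le
    have h3 : Λ * (s₀ / Λ) = s₀ := by field_simp
    linarith
  have hs1 : s ≤ 1 := le_trans hss₀ (min_le_right _ _)
  have hss₁ : s ≤ s₁ := le_trans hss₀ (le_trans (min_le_left _ _) (min_le_left _ _))
  have hss₂ : s ≤ s₂ := le_trans hss₀ (le_trans (min_le_left _ _) (min_le_right _ _))
  have hsL : 2 * R' ≤ s * L := by
    have : a β * L ≤ s * L := mul_le_mul_of_nonneg_right hsaβ (Nat.cast_nonneg L)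
    linarith
  have hRL : R' ≤ s * L := by linarith
  -- Riemann sums
  have hSv : s ^ 4 * ∑ z ∈ box 4 L, |v (s • siteToE z)| ≤ 2 := by
    have := h₁ s hs hss₁ L hRL; linarith
  have hSθ : s ^ 4 * ∑ y ∈ box 4 L, |(thetaTest 4 v) (s • siteToE y)| ≤ 2 := by
    have := h₂ s hs hss₂ L hRL
    rw [Summit.QuantumFields.YangMills.Cruxes.NT.CeilingPrice.integral_abs_thetaTest] at this
    linarith
  -- the kernel at `(β, L)`
  have hkerβ := hker β hβ0 L hLΛ₀
  -- (3)+(4)+(5): per charged pair, the collar sum of `|torusK3 x y z|` is at most `2κ(aβ)⁸`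
  set K : Set (EuclideanSpace ℝ (Fin 4)) :=
    tsupport (v : EuclideanSpace ℝ (Fin 4) → ℝ) ∪ tsupport (thetaTest 4 v : EuclideanSpace ℝ (Fin 4) → ℝ) with hKdef
  have hθpre := Summit.QuantumFields.YangMills.Cruxes.UVSeamRec.Q3MirrorFloors.tsupport_thetaTest_subset_preimage v
  have hpair : ∀ y ∈ box 4 L, ∀ z ∈ box 4 L, (thetaTest 4 v) (s • siteToE y) ≠ 0 → v (s • siteToE z) ≠ 0 →
      (∑ x ∈ box 4 L, (if infDist (s • siteToE x) K < R / 4 then |torusK3 G r β L x y z| else 0)) ≤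
        2 * ((η / 8) * (a β) ^ 8) := by
    intro y hy z hz hθy hvz
    -- coordinates and torus distance of the charged pair
    obtain ⟨hy1, hy2, hz1, hz2, hyR, hzR⟩ := pair_coords (s := s) hball hθy hvz
    have hlow : 2 * (p 0 / 2) ≤ s * ((z 0 : ℝ) - y 0) := by
      have : s * ((z 0 : ℝ) - y 0) = s * z 0 + -(s * y 0) := by ring
      rw [this]; linarith
    have hup : s * ((z 0 : ℝ) - y 0) ≤ 2 * R' := by
      have : s * ((z 0 : ℝ) - y 0) = s * z 0 + -(s * y 0) := by ring
      rw [this, hR']; linarith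
    obtain ⟨hd1, hd2⟩ := pair_torusDist hs (by positivity : (0 : ℝ) < p 0 / 2) hlow hup hyR hzR hsL
    have hdnn : 0 ≤ torusDist L y z := torusDist_nonneg L y z
    have hsep1 : p 0 / Λ ≤ a β * torusDist L y z := by
      rw [div_le_iff₀ hΛ0]
      have : torusDist L y z * s ≤ torusDist L y z * (Λ * a β) := mul_le_mul_of_nonneg_left hsΛ hdnn
      linarith
    have hsep2 : a β * torusDist L y z ≤ 2 * ‖p‖ + p 0 := by
      have : a β * torusDist L y z ≤ s * torusDist L y z := mul_le_mul_of_nonneg_right hsaβ hdnn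
      have h3 : 2 * R' ≤ 2 * ‖p‖ + p 0 := by rw [hR']; linarith
      linarith [mul_comm s (torusDist L y z)]
    have hsep1' : p 0 / Λ ≤ a β * torusDist L z y := by rw [torusDist_comm L z y]; exact hsep1
    have hsep2' : a β * torusDist L z y ≤ 2 * ‖p‖ + p 0 := by rw [torusDist_comm L z y]; exact hsep2
    have hS1 := hkerβ y hy z hz hsep1 hsep2
    have hS2 := hkerβ z hz y hy hsep1' hsep2'
    -- the collared points of `K`
    have hzK : s • siteToE z ∈ tsupport (v : EuclideanSpace ℝ (Fin 4) → ℝ) :=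
      subset_tsupport _ (Function.mem_support.2 hvz)
    have hKne : K.Nonempty := ⟨s • siteToE z, Set.mem_union_left _ hzK⟩
    have hzball : s • siteToE z ∈ closedBall p ρ := hball hzK
    have hyball : (timeReflection 4) (s • siteToE y) ∈ closedBall p ρ :=
      hball (hθpre (subset_tsupport _ (Function.mem_support.2 hθy)))
    -- pointwise domination of the collar indicator by the two kernel indicators
    have hpt : ∀ x ∈ box 4 L,
        (if infDist (s • siteToE x) K < R / 4 then |torusK3 G r β L x y z| else 0) ≤
          (if a β * torusDist L x z < R then |torusK3 G r β L x y z| else 0) +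
          (if a β * torusDist L x y < R then |torusK3 G r β L x z y| else 0) := by
      intro x _
      have h0z : 0 ≤ (if a β * torusDist L x z < R then |torusK3 G r β L x y z| else 0) := by
        split_ifs <;> positivity
      have h0y : 0 ≤ (if a β * torusDist L x y < R then |torusK3 G r β L x z y| else 0) := by
        split_ifs <;> positivity
      by_cases hcol : infDist (s • siteToE x) K < R / 4
      swap
      · rw [if_neg hcol]; positivity
      rw [if_pos hcol]
      obtain ⟨k, hkK, hk⟩ := (infDist_lt_iff hKne).1 hcol
      -- unit-`a` torus distance is below `s ·` Euclidean distance of the scaled sites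
      have hnear : ∀ w : Fin 4 → ℤ, dist (s • siteToE x) (s • siteToE w) < R → a β * torusDist L x w < R := by
        intro w hw
        have h1 : torusDist L x w ≤ ‖siteToE x - siteToE w‖ := torusDist_le_norm_sub L x w
        have h2 : dist (s • siteToE x) (s • siteToE w) = s * ‖siteToE x - siteToE w‖ := by
          rw [dist_eq_norm, ← smul_sub, norm_smul, Real.norm_of_nonneg hs.le]
        have h3 : a β * torusDist L x w ≤ s * ‖siteToE x - siteToE w‖ :=
          mul_le_mul hsaβ h1 (torusDist_nonneg L x w) hs.le
        linarith
      rcases (Set.mem_union _ _ _).1 hkK with hkv | hkθ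
      · -- `k` on the source side: `x` is near `z`
        have hkball : k ∈ closedBall p ρ := hball hkv
        have hxz : dist (s • siteToE x) (s • siteToE z) < R := by
          calc dist (s • siteToE x) (s • siteToE z)
              ≤ dist (s • siteToE x) k + dist k (s • siteToE z) := dist_triangle _ _ _
            _ ≤ dist (s • siteToE x) k + (dist k p + dist p (s • siteToE z)) := by
                linarith [dist_triangle k p (s • siteToE z)]
            _ < R / 4 + (ρ + ρ) := by
                have h1 : dist k p ≤ ρ := mem_closedBall.1 hkball
                have h2 : dist p (s • siteToE z) ≤ ρ := by rw [dist_comm]; exact mem_closedBall.1 hzball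
                linarith
            _ ≤ R := by linarith
        rw [if_pos (hnear z hxz)]
        linarith
      · -- `k` on the reflected side: `x` is near `y`
        have hkball : (timeReflection 4) k ∈ closedBall p ρ := hball (hθpre hkθ)
        have hky : dist k (s • siteToE y) ≤ ρ + ρ := by
          rw [← (timeReflection 4).isometry.dist_eq k (s • siteToE y)]
          calc dist ((timeReflection 4) k) ((timeReflection 4) (s • siteToE y))
              ≤ dist ((timeReflection 4) k) p + dist p ((timeReflection 4) (s • siteToE y)) := dist_triangle _ _ _
            _ ≤ ρ + ρ := by
                have h1 : dist ((timeReflection 4) k) p ≤ ρ := mem_closedBall.1 hkball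
                have h2 : dist p ((timeReflection 4) (s • siteToE y)) ≤ ρ := by
                  rw [dist_comm]; exact mem_closedBall.1 hyball
                linarith
        have hxy : dist (s • siteToE x) (s • siteToE y) < R := by
          calc dist (s • siteToE x) (s • siteToE y)
              ≤ dist (s • siteToE x) k + dist k (s • siteToE y) := dist_triangle _ _ _
            _ < R / 4 + (ρ + ρ) := by linarith
            _ ≤ R := by linarith
        rw [if_pos (hnear y hxy), torusK3_swap G r β L x y z]
        linarith
    calc (∑ x ∈ box 4 L, (if infDist (s • siteToE x) K < R / 4 then |torusK3 G r β L x y z| else 0))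
        ≤ ∑ x ∈ box 4 L, ((if a β * torusDist L x z < R then |torusK3 G r β L x y z| else 0) +
            (if a β * torusDist L x y < R then |torusK3 G r β L x z y| else 0)) := Finset.sum_le_sum hpt
      _ = (∑ x ∈ box 4 L, (if a β * torusDist L x z < R then |torusK3 G r β L x y z| else 0)) +
            ∑ x ∈ box 4 L, (if a β * torusDist L x y < R then |torusK3 G r β L x z y| else 0) :=
          Finset.sum_add_distrib
      _ ≤ (η / 8) * (a β) ^ 8 + (η / 8) * (a β) ^ 8 := add_le_add hS1 hS2
      _ = 2 * ((η / 8) * (a β) ^ 8) := by ring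
  -- (6) smearing: swap the sums and use the Riemann bounds
  set c : ℝ := 2 * ((η / 8) * (a β) ^ 8) with hc
  have hc0 : 0 ≤ c := by positivity
  have hterm : ∀ x ∈ box 4 L,
      (if infDist (s • siteToE x) K < R / 4 then
          |∑ y ∈ box 4 L, ∑ z ∈ box 4 L, (thetaTest 4 v) (s • siteToE y) * v (s • siteToE z) * torusK3 G r β L x y z|
        else 0) ≤
        ∑ y ∈ box 4 L, ∑ z ∈ box 4 L, |(thetaTest 4 v) (s • siteToE y)| * |v (s • siteToE z)| *
          (if infDist (s • siteToE x) K < R / 4 then |torusK3 G r β L x y z| else 0) := by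
    intro x _
    by_cases hcol : infDist (s • siteToE x) K < R / 4
    · simp only [if_pos hcol]
      calc |∑ y ∈ box 4 L, ∑ z ∈ box 4 L, (thetaTest 4 v) (s • siteToE y) * v (s • siteToE z) * torusK3 G r β L x y z|
          ≤ ∑ y ∈ box 4 L, |∑ z ∈ box 4 L, (thetaTest 4 v) (s • siteToE y) * v (s • siteToE z) * torusK3 G r β L x y z| :=
            Finset.abs_sum_le_sum_abs _ _
        _ ≤ ∑ y ∈ box 4 L, ∑ z ∈ box 4 L, |(thetaTest 4 v) (s • siteToE y) * v (s • siteToE z) * torusK3 G r β L x y z| :=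
            Finset.sum_le_sum fun y _ => Finset.abs_sum_le_sum_abs _ _
        _ = ∑ y ∈ box 4 L, ∑ z ∈ box 4 L, |(thetaTest 4 v) (s • siteToE y)| * |v (s • siteToE z)| *
              |torusK3 G r β L x y z| := by
            simp only [abs_mul]
    · simp only [if_neg hcol, mul_zero, Finset.sum_const_zero]
      exact le_rfl
  have hswap : ∑ x ∈ box 4 L, ∑ y ∈ box 4 L, ∑ z ∈ box 4 L, |(thetaTest 4 v) (s • siteToE y)| * |v (s • siteToE z)| *
        (if infDist (s • siteToE x) K < R / 4 then |torusK3 G r β L x y z| else 0) =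
      ∑ y ∈ box 4 L, ∑ z ∈ box 4 L, |(thetaTest 4 v) (s • siteToE y)| * |v (s • siteToE z)| *
        ∑ x ∈ box 4 L, (if infDist (s • siteToE x) K < R / 4 then |torusK3 G r β L x y z| else 0) := by
    rw [Finset.sum_comm]
    refine Finset.sum_congr rfl fun y _ => ?_
    rw [Finset.sum_comm]
    refine Finset.sum_congr rfl fun z _ => ?_
    rw [Finset.mul_sum]
  have hinner : ∀ y ∈ box 4 L, ∀ z ∈ box 4 L,
      |(thetaTest 4 v) (s • siteToE y)| * |v (s • siteToE z)| *
        (∑ x ∈ box 4 L, (if infDist (s • siteToE x) K < R / 4 then |torusK3 G r β L x y z| else 0)) ≤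
      |(thetaTest 4 v) (s • siteToE y)| * |v (s • siteToE z)| * c := by
    intro y hy z hz
    by_cases hθy : (thetaTest 4 v) (s • siteToE y) = 0
    · rw [hθy]; simp
    by_cases hvz : v (s • siteToE z) = 0
    · rw [hvz]; simp
    exact mul_le_mul_of_nonneg_left (hpair y hy z hz hθy hvz) (by positivity)
  have hSθ0 : 0 ≤ ∑ y ∈ box 4 L, |(thetaTest 4 v) (s • siteToE y)| := Finset.sum_nonneg fun _ _ => abs_nonneg _
  have hSv0 : 0 ≤ ∑ z ∈ box 4 L, |v (s • siteToE z)| := Finset.sum_nonneg fun _ _ => abs_nonneg _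
  have hs4 : 0 < s ^ 4 := by positivity
  have hprod : (∑ y ∈ box 4 L, |(thetaTest 4 v) (s • siteToE y)|) * (∑ z ∈ box 4 L, |v (s • siteToE z)|) * c ≤ η := by
    -- `(Σ|θv|)(Σ|v|) · 2κ(aβ)⁸ ≤ (2/s⁴)² · (η/4) (aβ)⁸ = η (aβ/s)⁸ ≤ η`
    have h1 : (∑ y ∈ box 4 L, |(thetaTest 4 v) (s • siteToE y)|) ≤ 2 / s ^ 4 := by
      rw [le_div_iff₀ hs4]; linarith [mul_comm (s ^ 4) (∑ y ∈ box 4 L, |(thetaTest 4 v) (s • siteToE y)|)]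
    have h2 : (∑ z ∈ box 4 L, |v (s • siteToE z)|) ≤ 2 / s ^ 4 := by
      rw [le_div_iff₀ hs4]; linarith [mul_comm (s ^ 4) (∑ z ∈ box 4 L, |v (s • siteToE z)|)]
    have h3 : (∑ y ∈ box 4 L, |(thetaTest 4 v) (s • siteToE y)|) * (∑ z ∈ box 4 L, |v (s • siteToE z)|) * c ≤
        (2 / s ^ 4) * (2 / s ^ 4) * c :=
      mul_le_mul_of_nonneg_right (mul_le_mul h1 h2 hSv0 (by positivity)) hc0
    have h4 : (a β) ^ 8 ≤ s ^ 8 := pow_le_pow_left₀ haβ.le hsaβ 8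
    have h5 : (2 / s ^ 4) * (2 / s ^ 4) * c = η * ((a β) ^ 8 / s ^ 8) := by
      rw [hc]; field_simp; ring
    have h6 : (a β) ^ 8 / s ^ 8 ≤ 1 := by
      rw [div_le_one (by positivity)]; exact h4
    calc _ ≤ (2 / s ^ 4) * (2 / s ^ 4) * c := h3
      _ = η * ((a β) ^ 8 / s ^ 8) := h5
      _ ≤ η * 1 := mul_le_mul_of_nonneg_left h6 hη.le
      _ = η := mul_one η
  calc (∑ x ∈ box 4 L, (if infDist (s • siteToE x) K < R / 4 then
          |∑ y ∈ box 4 L, ∑ z ∈ box 4 L, (thetaTest 4 v) (s • siteToE y) * v (s • siteToE z) * torusK3 G r β L x y z|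
        else 0))
      ≤ ∑ x ∈ box 4 L, ∑ y ∈ box 4 L, ∑ z ∈ box 4 L, |(thetaTest 4 v) (s • siteToE y)| * |v (s • siteToE z)| *
          (if infDist (s • siteToE x) K < R / 4 then |torusK3 G r β L x y z| else 0) := Finset.sum_le_sum hterm
    _ = ∑ y ∈ box 4 L, ∑ z ∈ box 4 L, |(thetaTest 4 v) (s • siteToE y)| * |v (s • siteToE z)| *
          ∑ x ∈ box 4 L, (if infDist (s • siteToE x) K < R / 4 then |torusK3 G r β L x y z| else 0) := hswap
    _ ≤ ∑ y ∈ box 4 L, ∑ z ∈ box 4 L, |(thetaTest 4 v) (s • siteToE y)| * |v (s • siteToE z)| * c :=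
        Finset.sum_le_sum fun y hy => Finset.sum_le_sum fun z hz => hinner y hy z hz
    _ = (∑ y ∈ box 4 L, |(thetaTest 4 v) (s • siteToE y)|) * (∑ z ∈ box 4 L, |v (s • siteToE z)|) * c := by
        rw [Finset.sum_mul, Finset.sum_mul]
        refine Finset.sum_congr rfl fun y _ => ?_
        rw [Finset.mul_sum, Finset.sum_mul]
    _ ≤ η := hprod
    _ ≤ η * (1 + |deriv (fun c : ℝ => Q2 G r c L s (thetaTest 4 v) v) β|) :=
        le_mul_of_one_le_right hη.le (by linarith [abs_nonneg (deriv (fun c : ℝ => Q2 G r c L s (thetaTest 4 v) v) β)])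

end Summit.QuantumFields.YangMills.Cruxes.ResponseLocalisation.Collar

end
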